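import Summits.ResolutionOfSingularities.ResolutionOfSingularities.Theorems.ValuativeLuAlphaPTorsorCurveMonomializationDivisors
import Summits.ResolutionOfSingularities.ResolutionOfSingularities.Theorems.ValuativeLuAlphaPTorsorCurveMonomializationStep
import Literature.AlgebraicGeometry.Resolution.MonomializationAlongValuation

/-!
# The endgame of embedded resolution of a plane curve germ along a valuation: monomial forms

Helper file for the stub `stub_curveMonomialization` of the line `pfaff-line-log-final-forms`
(crux `Valuative.LuAlphaPTorsor`, item `stmt-ResolutionOfSingularities-0641`).

PROVED:

* `monomial_of_good` — **monomial form from a normal-crossings support**: if `S` is a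
  two-dimensional regular local ring of `K` with `𝔪_S = (u, v)` and every prime divisor of
  `0 ≠ b ∈ S` (valuation ring `W ⊇ S`, `w(b) > 0`, not dominating `S`) passes through `u = 0` or
  `v = 0`, then `b = unit · uᵃ vᶜ` (every prime containing `b` contains `u` or `v`, and
  `exists_isUnit_mul_prod_pow_of_forall_prime`);
* `monomial_of_mem_or_inv_mem` — the same in a member of the sequence which is a discrete
  valuation ring of `K` (`b = unit · ϖⁿ`);
* `exists_regular_parameter_of_dominates` — an exceptional divisor is regular at birth: if `W`
  dominates `R` but not its quadratic transform `R₁` then `𝔪_W ∩ R₁ ∋ x`, the chart element, a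
  member of a regular system of parameters of `R₁`;
* `eq_of_mem_or_inv_mem` — a valuation ring of `K` dominated by `O` is `O`.

All [folklore] (Zariski; Abhyankar 1956).
-/

set_option linter.dupNamespace false

namespace Summit.ResolutionOfSingularities.ResolutionOfSingularities.Theorems.PfaffLine.CurveMono

open IsLocalRing Literature.AlgebraicGeometry.Resolution

variable {K : Type} [Field K]

/-- A subring of `K` which is a valuation ring of `K` and is dominated by the valuation ring `O`
equals `O`. [folklore] -/
theorem eq_of_mem_or_inv_mem {O : ValuationSubring K} {S : Subring K}
    (hdom : SubringDominates S O.toSubring) (hval : ∀ z : K, z ∈ S ∨ z⁻¹ ∈ S) :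
    S = O.toSubring := by
  refine le_antisymm hdom.1 fun z hz => ?_
  rcases hval z with h | h
  · exact h
  · by_cases hz0 : z = 0
    · rw [hz0]; exact S.zero_mem
    · have := hdom.2 z⁻¹ h (by rw [inv_inv]; exact hz)
      rwa [inv_inv] at this

/-- **An exceptional divisor is regular at birth.** If the valuation ring `W` dominates the
two-dimensional regular local ring `R` of `K` then on its quadratic transform `R₁` along `O` the
chart element `x ∈ 𝔪_R` has `w(x) > 0` and lies outside `𝔪_{R₁}²` (`𝔪_{R₁} = (x, f)`).
[folklore] -/
theorem exists_regular_parameter_of_dominates {O W : ValuationSubring K} {R R₁ : Subring K}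
    [IsRegularLocalRing R] [IsRegularLocalRing R₁] (hdim : ringKrullDim R = 2)
    (hdim₁ : ringKrullDim R₁ = 2) (hO : SubringDominates R O.toSubring)
    (h : IsQuadraticTransformAlong O R R₁) (hdomW : SubringDominates R W.toSubring) :
    ∃ q : R₁, W.valuation (q : K) < 1 ∧ q ∉ maximalIdeal R₁ ^ 2 := by
  obtain ⟨x, f, hxR, hxinv, hm₁⟩ := exists_maximalIdeal_eq_span_pair_of_step hdim hO h
  refine ⟨x, ?_, not_mem_sq_of_span_pair hdim₁ hm₁⟩
  have hxm : (⟨(x : K), hxR⟩ : R) ∈ maximalIdeal R :=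
    (mem_maximalIdeal_iff_inv_not_mem _).mpr (Or.inr hxinv)
  exact valuation_lt_one_of_dominates hdomW hxm

/-- **Monomial form in a discrete valuation ring of `K`.** If the regular local subring `S` of
`K` is a valuation ring of `K` with a nonzero non-unit, then it is a discrete valuation ring and
every `0 ≠ b ∈ S` is `ϖⁿ · unit` for a uniformiser `ϖ` (`𝔪_S = (ϖ)`, `dim S = 1`). [folklore] -/
theorem monomial_of_mem_or_inv_mem {S : Subring K} [IsRegularLocalRing S]
    (hval : ∀ z : K, z ∈ S ∨ z⁻¹ ∈ S) {x : K} (hxS : x ∈ S) (hx0 : x ≠ 0) (hxinv : x⁻¹ ∉ S)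
    {b : K} (hbS : b ∈ S) (hb0 : b ≠ 0) :
    ∃ (d : ℕ) (u : Fin d → S) (M : Fin d → ℕ) (w : S), IsUnit w ∧
      (∀ z : S, z ∈ Ideal.span (Set.range u) ↔ ¬ IsUnit z) ∧ ringKrullDim S = d ∧
      b = (∏ j, ((u j : S) : K) ^ M j) * ((w : S) : K) := by
  haveI : ValuationRing S := by
    refine { cond' := fun a c => ?_ }
    rcases hval ((a : K) / c) with hz | hz
    · by_cases hc0 : (c : K) = 0
      · exact ⟨0, Or.inl (Subtype.ext (by simp [hc0]))⟩
      · refine ⟨⟨_, hz⟩, Or.inr (Subtype.ext ?_)⟩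
        change (c : K) * (a / c) = a
        field_simp
    · by_cases ha : (a : K) = 0
      · exact ⟨0, Or.inr (Subtype.ext (by simp [ha]))⟩
      · refine ⟨⟨_, hz⟩, Or.inl (Subtype.ext ?_)⟩
        change (a : K) * ((a : K) / c)⁻¹ = c
        by_cases hc0 : (c : K) = 0
        · simp [hc0]
        · field_simp
  haveI : IsPrincipalIdealRing S :=
    ((tfae_of_isNoetherianRing_of_isLocalRing_of_isDomain S).out 0 1).mpr ‹_›
  have hnf : maximalIdeal S ≠ ⊥ := fun h => by
    have hxm : (⟨x, hxS⟩ : S) ∈ maximalIdeal S :=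
      (mem_maximalIdeal_iff_inv_not_mem _).mpr (Or.inr hxinv)
    rw [h, Ideal.mem_bot] at hxm
    exact hx0 (congrArg Subtype.val hxm)
  haveI : IsDiscreteValuationRing S :=
    { toIsPrincipalIdealRing := ‹_›, toIsLocalRing := inferInstance, not_a_field' := hnf }
  obtain ⟨ϖ, hϖ⟩ := IsDiscreteValuationRing.exists_irreducible S
  have hm : maximalIdeal S = Ideal.span {ϖ} :=
    (IsDiscreteValuationRing.irreducible_iff_uniformizer ϖ).mp hϖ
  have hb0' : (⟨b, hbS⟩ : S) ≠ 0 := fun h => hb0 (congrArg Subtype.val h)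
  obtain ⟨n, w, hw⟩ := IsDiscreteValuationRing.associated_pow_irreducible hb0' hϖ
  refine ⟨1, fun _ => ϖ, fun _ => n, ↑w⁻¹, Units.isUnit _, fun z => ?_, ?_, ?_⟩
  · rw [Set.range_const, ← hm]
    exact IsLocalRing.mem_maximalIdeal _
  · rw [IsDiscreteValuationRing.ringKrullDim_eq_one S, Nat.cast_one]
  · rw [Fin.prod_univ_one]
    have e : (⟨b, hbS⟩ : S) = ϖ ^ n * ↑w⁻¹ := by rw [← hw, Units.mul_inv_cancel_right]
    have e' := congrArg Subtype.val e
    push_cast at e'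
    exact e'

/-- **Monomial form from a normal-crossings support.** Let `S` be a two-dimensional regular local
ring of `K` (`Frac S = K`), `𝔪_S = (u, v)`, and `0 ≠ b ∈ S` such that every valuation ring
`W ⊇ S` with `w(b) > 0` not dominating `S` has `w(u) > 0` or `w(v) > 0`. Then every prime of
`S` containing `b` contains `u` or `v` (a prime `𝔭 ≠ 𝔪_S` is the centre of the valuation ring
`S_𝔭`), so `b = w uᵃ vᶜ` with `w` a unit (`exists_isUnit_mul_prod_pow_of_forall_prime`).
[folklore] -/
theorem monomial_of_good {S : Subring K} [IsRegularLocalRing S] (hdim : ringKrullDim S = 2)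
    (hof : IsLocalRingOf S) {b : K} (hbS : b ∈ S) (hb0 : b ≠ 0) {u v : S}
    (huv : maximalIdeal S = Ideal.span {u, v})
    (hV : ∀ W : ValuationSubring K, S ≤ W.toSubring → W.valuation b < 1 →
      ¬ SubringDominates S W.toSubring → W.valuation (u : K) < 1 ∨ W.valuation (v : K) < 1) :
    ∃ (d : ℕ) (x : Fin d → S) (M : Fin d → ℕ) (w : S), IsUnit w ∧
      (∀ z : S, z ∈ Ideal.span (Set.range x) ↔ ¬ IsUnit z) ∧ ringKrullDim S = d ∧
      b = (∏ j, ((x j : S) : K) ^ M j) * ((w : S) : K) := by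
  have hrange : Set.range ![u, v] = {u, v} := Matrix.range_cons_cons_empty u v ![]
  have hum : u ∈ maximalIdeal S := huv ▸ Ideal.subset_span (by simp)
  have hvm : v ∈ maximalIdeal S := huv ▸ Ideal.subset_span (by simp)
  have hu2 : u ∉ maximalIdeal S ^ 2 := not_mem_sq_of_span_pair hdim huv
  have hv2 : v ∉ maximalIdeal S ^ 2 :=
    not_mem_sq_of_span_pair hdim (by rw [huv, Set.pair_comm])
  have hxm : ∀ i, ![u, v] i ∈ maximalIdeal S ∧ ![u, v] i ∉ maximalIdeal S ^ 2 := by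
    intro i
    fin_cases i
    · exact ⟨hum, hu2⟩
    · exact ⟨hvm, hv2⟩
  have hb0' : (⟨b, hbS⟩ : S) ≠ 0 := fun h => hb0 (congrArg Subtype.val h)
  have hsupp : ∀ 𝔭 : Ideal S, 𝔭.IsPrime → (⟨b, hbS⟩ : S) ∈ 𝔭 → ∃ i, ![u, v] i ∈ 𝔭 := by
    intro 𝔭 h𝔭 hb𝔭
    by_cases h𝔭m : 𝔭 = maximalIdeal S
    · exact ⟨0, by rw [h𝔭m]; exact hum⟩
    · haveI := h𝔭
      obtain ⟨W, -, hSW, hWval, hnd, -⟩ := exists_valuationSubring_of_prime hdim hof 𝔭 h𝔭m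
      have hbW : W.valuation b < 1 := (hWval ⟨b, hbS⟩).mpr hb𝔭
      rcases hV W hSW hbW hnd with hu | hv
      · exact ⟨0, (hWval u).mp hu⟩
      · exact ⟨1, (hWval v).mp hv⟩
  obtain ⟨w, α, hw, hbw⟩ :=
    exists_isUnit_mul_prod_pow_of_forall_prime ![u, v] hxm ⟨b, hbS⟩ hb0' hsupp
  refine ⟨2, ![u, v], α, w, hw, fun z => ?_, ?_, ?_⟩
  · rw [hrange, ← huv]
    exact IsLocalRing.mem_maximalIdeal _
  · rw [hdim, Nat.cast_ofNat]
  · have e := congrArg Subtype.val hbw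
    push_cast at e
    rw [e, mul_comm]

end Summit.ResolutionOfSingularities.ResolutionOfSingularities.Theorems.PfaffLine.CurveMono

namespace Summit.ResolutionOfSingularities.ResolutionOfSingularities.Theorems.PfaffLine

/-- **Registered sub-goal `curveMono_monomial_of_good`** (universe `0`, for `--supports`
registration): monomial form of `b` in a two-dimensional regular local ring of `K` all of whose
prime divisors of `b` pass through `u = 0` or `v = 0`, `𝔪 = (u, v)`. [folklore] -/
theorem curveMono_monomial_of_good : ∀ {K : Type} [Field K] {S : Subring K} [IsRegularLocalRing S], ringKrullDim S = 2 → Literature.AlgebraicGeometry.Resolution.IsLocalRingOf S → ∀ {b : K}, b ∈ S → b ≠ 0 → ∀ {u v : S}, IsLocalRing.maximalIdeal S = Ideal.span {u, v} → (∀ W : ValuationSubring K, S ≤ W.toSubring → W.valuation b < 1 → ¬ Literature.AlgebraicGeometry.Resolution.SubringDominates S W.toSubring → W.valuation (u : K) < 1 ∨ W.valuation (v : K) < 1) → ∃ (d : ℕ) (x : Fin d → S) (M : Fin d → ℕ) (w : S), IsUnit w ∧ (∀ z : S, z ∈ Ideal.span (Set.range x) ↔ ¬ IsUnit z) ∧ ringKrullDim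 S = (d : WithBot ℕ∞) ∧ b = (Finset.univ.prod fun j => ((x j : S) : K) ^ M j) * ((w : S) : K) := by
  intro K _ S _ hdim hof b hbS hb0 u v huv hV
  exact CurveMono.monomial_of_good hdim hof hbS hb0 huv hV

end Summit.ResolutionOfSingularities.ResolutionOfSingularities.Theorems.PfaffLine
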